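import Mathlib.LinearAlgebra.Matrix.PosDef
import Mathlib.Analysis.Matrix.Hermitian
import Mathlib.Analysis.Complex.Order
import Mathlib.Data.Complex.BigOperators
import HarnessLib

/-!
# The real form of a Hermitian semidefinite block — Horn–Johnson, *Matrix Analysis*, 1.3.P20

Topic `Literature/Computation/Certificates` (joins `SemidefiniteRigorousBounds.lean`,
`LagrangianSplitBound.lean`, `TraceFormBlocks.lean`: kernel-checkable certificate arithmetic).

Every SDP engine and every exact certificate reader in the fleet works with REAL symmetric matrices;
a complex Hermitian constraint `H = C + iS ⪰ 0` (`C` real symmetric, `S` real antisymmetric — e.g. a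
first-moment momentum block `M₁(q)` at `q ∉ {0, π}ℤ²`) is imposed through its *real form*

  `R(H) = [[C, −S], [S, C]] ⪰ 0`   (a real symmetric `2n × 2n` matrix).

Source: R. A. Horn, C. R. Johnson, *Matrix Analysis*, 2nd ed., CUP 2013 [HornJohnson2013], Problem
**1.3.P20**: for `A = A₁ + iA₂` the real representation `R₁(A) = [[A₁, A₂], [−A₂, A₁]]` satisfies
(f) `U⁻¹ R₁(A) U = A ⊕ Ā` for the unitary `U = 2^{-1/2} [[I, iI], [iI, I]]`, (g) "the eigenvalues of `R₁(A)`
are the same as the eigenvalues of `A ⊕ Ā`", and (l) "`A` is Hermitian if and only if `R₁(A)` is (real)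
symmetric" — whence `A ⪰ 0 ⟺ R₁(A) ⪰ 0` for Hermitian `A` (held copy `book:horn2012-matrix-analysis`
p0102–p0103). Our `realForm C S = [[C, −S], [S, C]]` is `R₁(H)ᵀ = R₁(H̄)`, which has the same spectrum.

What is proved (directly on quadratic forms, the computation behind (f)/(g): for `z = x + iy`,
`Re (z* H z) = [x; y]ᵀ R(H) [x; y]` TERMWISE, and `Im (z* H z) = 0` for Hermitian `H`):

* `RealForm.realForm C S`, `RealForm.complexForm C S` (`= C + iS`, entrywise `⟨C_ab, S_ab⟩`);
* `RealForm.re_star_dotProduct_mulVec` — the quadratic-form identity (no symmetry hypothesis);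
* `RealForm.isHermitian_complexForm`, `RealForm.isSymm_realForm` — from `Cᵀ = C`, `Sᵀ = −S`;
* `RealForm.posSemidef_complexForm_iff` — **`C + iS ⪰ 0 ⟺ [[C, −S], [S, C]] ⪰ 0`** (`Cᵀ = C`, `Sᵀ = −S`).

No `Prop` definitions, no named facts; everything is proved.
-/

namespace Literature.Computation.Certificates

open Matrix Finset
open scoped ComplexOrder

namespace RealForm

variable {n : Type*}

/-- The real form `R(H) = [[C, −S], [S, C]]` of the complex matrix `H = C + iS`
(Horn–Johnson's `R₁(H̄) = R₁(H)ᵀ`). [cite: HornJohnson2013, Problem 1.3.P20] -/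
def realForm (C S : Matrix n n ℝ) : Matrix (n ⊕ n) (n ⊕ n) ℝ :=
  Matrix.fromBlocks C (-S) S C

/-- The complex matrix `H = C + iS` with real part `C` and imaginary part `S`, entrywise.
[cite: HornJohnson2013, Problem 1.3.P20] -/
def complexForm (C S : Matrix n n ℝ) : Matrix n n ℂ :=
  Matrix.of fun a b => (⟨C a b, S a b⟩ : ℂ)

/-- Entries of `complexForm` (definition unfolding). [cite: HornJohnson2013, Problem 1.3.P20] -/
@[simp] theorem complexForm_apply (C S : Matrix n n ℝ) (a b : n) :
    complexForm C S a b = (⟨C a b, S a b⟩ : ℂ) := rfl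

/-- `realForm` unfolds to `fromBlocks C (−S) S C` (definition unfolding).
[cite: HornJohnson2013, Problem 1.3.P20] -/
theorem realForm_eq (C S : Matrix n n ℝ) : realForm C S = Matrix.fromBlocks C (-S) S C := rfl

section QuadraticForm

variable [Fintype n]

/-- **The quadratic-form identity behind Horn–Johnson 1.3.P20 (f)/(g):** for `z = x + iy`,
`Re (z* (C + iS) z) = [x; y]ᵀ [[C, −S], [S, C]] [x; y]`, TERM BY TERM (no symmetry of `C`, `S` needed):
`Re( conj(z_a) (C_ab + iS_ab) z_b ) = C_ab (x_a x_b + y_a y_b) + S_ab (y_a x_b − x_a y_b)`.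
[cite: HornJohnson2013, Problem 1.3.P20] -/
theorem re_star_dotProduct_mulVec (C S : Matrix n n ℝ) (z : n → ℂ) :
    (star z ⬝ᵥ (complexForm C S *ᵥ z)).re =
      Sum.elim (fun a => (z a).re) (fun a => (z a).im) ⬝ᵥ
        (realForm C S *ᵥ Sum.elim (fun a => (z a).re) (fun a => (z a).im)) := by
  -- left-hand side as a double sum of real numbers
  have hL : (star z ⬝ᵥ (complexForm C S *ᵥ z)).re =
      ∑ a, ∑ b, (C a b * ((z a).re * (z b).re + (z a).im * (z b).im)
        + S a b * ((z a).im * (z b).re - (z a).re * (z b).im)) := by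
    simp only [dotProduct, mulVec, Complex.re_sum, Finset.mul_sum, Pi.star_apply]
    refine Finset.sum_congr rfl fun a _ => Finset.sum_congr rfl fun b _ => ?_
    simp only [complexForm_apply, Complex.mul_re, Complex.mul_im, Complex.star_def, Complex.conj_re,
      Complex.conj_im]
    ring
  -- right-hand side as the same double sum
  have hR : Sum.elim (fun a => (z a).re) (fun a => (z a).im) ⬝ᵥ
        (realForm C S *ᵥ Sum.elim (fun a => (z a).re) (fun a => (z a).im)) =
      ∑ a, ∑ b, (C a b * ((z a).re * (z b).re + (z a).im * (z b).im)
        + S a b * ((z a).im * (z b).re - (z a).re * (z b).im)) := by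
    rw [realForm_eq, Matrix.fromBlocks_mulVec, dotProduct, Fintype.sum_sum_type]
    simp only [Sum.elim_inl, Sum.elim_inr, Sum.elim_comp_inl, Sum.elim_comp_inr, Pi.add_apply, mulVec,
      dotProduct, Matrix.neg_apply]
    rw [← Finset.sum_add_distrib]
    refine Finset.sum_congr rfl fun a _ => ?_
    rw [mul_add, mul_add, Finset.mul_sum, Finset.mul_sum, Finset.mul_sum, Finset.mul_sum,
      ← Finset.sum_add_distrib, ← Finset.sum_add_distrib, ← Finset.sum_add_distrib]
    refine Finset.sum_congr rfl fun b _ => ?_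
    ring
  rw [hL, hR]

omit [Fintype n] in
/-- `C + iS` is Hermitian when `C` is symmetric and `S` antisymmetric (Horn–Johnson 1.3.P20 (l)).
[cite: HornJohnson2013, Problem 1.3.P20] -/
theorem isHermitian_complexForm {C S : Matrix n n ℝ} (hC : Cᵀ = C) (hS : Sᵀ = -S) :
    (complexForm C S).IsHermitian := by
  ext a b
  apply Complex.ext
  · show (starRingEnd ℂ (⟨C b a, S b a⟩ : ℂ)).re = C a b
    rw [Complex.conj_re]
    have h : C b a = C a b := by
      have h' := congrFun (congrFun hC a) b
      rwa [transpose_apply] at h'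
    exact h
  · show (starRingEnd ℂ (⟨C b a, S b a⟩ : ℂ)).im = S a b
    rw [Complex.conj_im]
    have h : S b a = -S a b := by
      have h' := congrFun (congrFun hS a) b
      rwa [transpose_apply, Matrix.neg_apply] at h'
    show -S b a = S a b
    rw [h, neg_neg]

omit [Fintype n] in
/-- `[[C, −S], [S, C]]` is symmetric when `C` is symmetric and `S` antisymmetric
(Horn–Johnson 1.3.P20 (l)). [cite: HornJohnson2013, Problem 1.3.P20] -/
theorem isSymm_realForm {C S : Matrix n n ℝ} (hC : Cᵀ = C) (hS : Sᵀ = -S) :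
    (realForm C S).IsHermitian := by
  rw [IsHermitian, realForm_eq, conjTranspose_eq_transpose_of_trivial, fromBlocks_transpose, hC, hS,
    transpose_neg, hS, neg_neg]

/-- **Real form of a Hermitian semidefinite constraint (Horn–Johnson 1.3.P20 (f), (g), (l)):**
for `C` real symmetric and `S` real antisymmetric, `C + iS ⪰ 0 ⟺ [[C, −S], [S, C]] ⪰ 0`. This is the
exact statement an SDP engine / rational certificate reader uses to impose a complex Hermitian block
(e.g. a first-moment momentum block `M₁(q) = C + iS`) as a real symmetric block of twice the size.
[cite: HornJohnson2013, Problem 1.3.P20] -/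
theorem posSemidef_complexForm_iff {C S : Matrix n n ℝ} (hC : Cᵀ = C) (hS : Sᵀ = -S) :
    (complexForm C S).PosSemidef ↔ (realForm C S).PosSemidef := by
  constructor
  · intro h
    refine PosSemidef.of_dotProduct_mulVec_nonneg (isSymm_realForm hC hS) fun v => ?_
    -- write v = [x; y] and take z = x + iy
    set z : n → ℂ := fun a => ⟨v (Sum.inl a), v (Sum.inr a)⟩ with hz
    have hv : v = Sum.elim (fun a => (z a).re) (fun a => (z a).im) := by
      ext i; rcases i with a | a <;> rfl
    have h1 := h.dotProduct_mulVec_nonneg z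
    rw [Complex.nonneg_iff, re_star_dotProduct_mulVec] at h1
    rw [star_trivial, hv]
    exact h1.1
  · intro h
    refine PosSemidef.of_dotProduct_mulVec_nonneg (isHermitian_complexForm hC hS) fun z => ?_
    rw [Complex.nonneg_iff, re_star_dotProduct_mulVec]
    refine ⟨?_, ?_⟩
    · have h1 := h.dotProduct_mulVec_nonneg (Sum.elim (fun a => (z a).re) (fun a => (z a).im))
      rwa [star_trivial] at h1
    · have h2 := (isHermitian_complexForm hC hS).im_star_dotProduct_mulVec_self z
      rw [RCLike.im_to_complex] at h2
      exact h2.symm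

end QuadraticForm

end RealForm

end Literature.Computation.Certificates
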